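import Mathlib
import Summits.MatrixMultiplication.MatrixMultiplication.Theorems.SnSubsetDichotomyPolynomialSlackBlockCounts
import Summits.MatrixMultiplication.MatrixMultiplication.Theorems.SnSubsetDichotomyPolynomialSlackHubFibring
import Summits.MatrixMultiplication.MatrixMultiplication.Theorems.SnSubsetDichotomyPolynomialSlackGoodValueOfSum
import Summits.MatrixMultiplication.MatrixMultiplication.Theorems.SnSubsetDichotomyPolynomialSlackSpreadLevelOne

/-!
# The hub block: from forced hits to one-point fibring (block volume step)

Crux `Summit.MatrixMultiplication.MatrixMultiplication.Theses.SnSubsetDichotomy.PolynomialSlack`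
(item `stmt-MatrixMultiplication-8306`), level-one programme, lead c8 (general hub lemma, block volume step).

For a TPP triple `S, T, U ⊆ S_n` of non-empty sets with quotient profiles `d_A = m_{ST}/|S||T|`,
`d_B = m_{TU}/|T||U|`, `d_C = m_{US}/|U||S|`, a hub position `k` of `U` and a BLOCK `J₀ × I₀` of positions
on which the links to the hub lie in dyadic ranges, `β ≤ d_B(j,k) ≤ 2β` (`j ∈ J₀`) and
`γ ≤ d_C(k,i) ≤ 2γ` (`i ∈ I₀`), write `μ(v) = #{u ∈ U : u k = v}/|U|`, `X(v) = #{t ∈ T : t⁻¹ v ∈ J₀}/|T|`,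
`Y(v) = #{s ∈ S : s⁻¹ v ∈ I₀}/|S|`. If `Σ_v μ X Y ≥ 2q` and `Σ_{I₀ × J₀} d_A d_B d_C ≤ η/n`, then for every
bound `B` on the volumes of TPP triples of `S_{n-1}` and every `W ≥ |J₀||I₀|`:

  `|S||T||U| ≤ W²·η·B/(q⁴·n)`          (`hubBlock_volume_le`).

Proof. (1) HUB MASSES: `Σ_{j ∈ J₀} d_B(j,k) = Σ_v μ X ≥ Σ_v μ X Y ≥ 2q` (`sum_pairMarginal_col_block_eq`,
`Y ≤ 1`), and `Σ_{j ∈ J₀} d_B(j,k) ≤ 2β|J₀|`, so `q ≤ β|J₀|`; symmetrically `q ≤ γ|I₀|`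
(`sum_pairMarginal_row_block_eq`). (2) FORCED HITS: `Σ_v X Y = Σ_{I₀ × J₀} d_A` (`sum_pairMarginal_block_eq`)
and on the block `βγ·d_A ≤ d_A d_B d_C`, so `Σ_v X Y ≤ (η/n)/(βγ) =: Z`. (3) GOOD VALUE
(`exists_good_value_of_sum`): some `v` has `μ(v)X(v)Y(v) ≥ q²/Z`. (4) FIBRING (`hub_fibring`):
`|S||T||U|·μ(v)X(v)Y(v) = #{s : s⁻¹v ∈ I₀}·#{t : t⁻¹v ∈ J₀}·#{u : u k = v} ≤ |I₀||J₀|·B`, whence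
`|S||T||U|·q²·n·βγ ≤ |I₀||J₀|·B·η` and, by `q² ≤ βγ|J₀||I₀|`, `|S||T||U|·q⁴·n ≤ (|J₀||I₀|)²·η·B ≤ W²·η·B`.
-/

namespace Summit.MatrixMultiplication.MatrixMultiplication.Theorems.PolynomialSlack

open scoped BigOperators
open Literature.Combinatorics.Additive (TripleProductProperty)

-- `Summit.<Summit>.<Problem>` is the tree's mandated summit-side namespace (CONVENTIONS §2); for
-- this single-conjunct summit the two coincide, so each declaration silences `dupNamespace`.
set_option linter.dupNamespace false

set_option maxHeartbeats 1600000 in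
/-- **The hub block volume bound.** For `n ≥ 1`, a bound `B` on the volumes of TPP triples of `S_{n-1}`,
a TPP triple `S, T, U ⊆ S_n` of non-empty sets with quotient profiles `dA, dB, dC`, a hub position `k`,
blocks `J₀, I₀` with dyadic links `β ≤ dB j k ≤ 2β` (`j ∈ J₀`), `γ ≤ dC k i ≤ 2γ` (`i ∈ I₀`), hub mass
`Σ_v μ(v)·X(v)·Y(v) ≥ 2q` (`μ, X, Y` the value distribution of `U` at `k` and the block profiles of `T`, `S`),
block weight `Σ_{I₀ × J₀} dA·dB·dC ≤ η/n` and `|J₀||I₀| ≤ W`: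
`|S||T||U| ≤ W²·η·B/(q⁴·n)` — hub masses, forced hits, a good common value and hub fibring. [folklore] -/
theorem hubBlock_volume_le {n : ℕ} (hn : 1 ≤ n) (B : ℕ)
    (hB : ∀ S' T' U' : Finset (Equiv.Perm (Fin (n - 1))), TripleProductProperty S' T' U' →
      S'.card * T'.card * U'.card ≤ B)
    {S T U : Finset (Equiv.Perm (Fin n))} (hTPP : TripleProductProperty S T U)
    (hS0 : S.Nonempty) (hT0 : T.Nonempty) (hU0 : U.Nonempty)
    (dA dB dC : Fin n → Fin n → ℝ)
    (hdA : ∀ i j, dA i j = (((S ×ˢ T).filter fun st => st.2 j = st.1 i).card : ℝ) / (S.card * T.card : ℕ))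
    (hdB : ∀ j k, dB j k = (((T ×ˢ U).filter fun tu => tu.2 k = tu.1 j).card : ℝ) / (T.card * U.card : ℕ))
    (hdC : ∀ k i, dC k i = (((U ×ˢ S).filter fun us => us.2 i = us.1 k).card : ℝ) / (U.card * S.card : ℕ))
    (k : Fin n) (J₀ I₀ : Finset (Fin n)) (β γ q η W : ℝ) (hβ : 0 < β) (hγ : 0 < γ) (hq : 0 < q)
    (hη : 0 < η)
    (hJ₀ : ∀ j ∈ J₀, β ≤ dB j k ∧ dB j k ≤ 2 * β) (hI₀ : ∀ i ∈ I₀, γ ≤ dC k i ∧ dC k i ≤ 2 * γ)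
    (hlow : 2 * q ≤ ∑ v : Fin n, ((U.filter fun u => u k = v).card : ℝ) / U.card *
        ((((T.filter fun t => t⁻¹ v ∈ J₀).card : ℝ) / T.card) *
          (((S.filter fun s => s⁻¹ v ∈ I₀).card : ℝ) / S.card)))
    (hΨ : ∑ i ∈ I₀, ∑ j ∈ J₀, dA i j * dB j k * dC k i ≤ η / n)
    (hW : (J₀.card : ℝ) * I₀.card ≤ W) :
    ((S.card * T.card * U.card : ℕ) : ℝ) ≤ W ^ 2 * η * B / (q ^ 4 * n) := by
  classical
  /- 0. scalars -/
  have hn0 : (0 : ℝ) < n := by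
    have h : (1 : ℝ) ≤ n := by exact_mod_cast hn
    linarith
  set cS : ℝ := (S.card : ℝ) with hcS
  set cT : ℝ := (T.card : ℝ) with hcT
  set cU : ℝ := (U.card : ℝ) with hcU
  have hcS0 : 0 < cS := by rw [hcS]; exact_mod_cast hS0.card_pos
  have hcT0 : 0 < cT := by rw [hcT]; exact_mod_cast hT0.card_pos
  have hcU0 : 0 < cU := by rw [hcU]; exact_mod_cast hU0.card_pos
  have hαe : ((S.card * T.card : ℕ) : ℝ) = cS * cT := by push_cast; rw [hcS, hcT]
  have hβe : ((T.card * U.card : ℕ) : ℝ) = cT * cU := by push_cast; rw [hcT, hcU]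
  have hγe : ((U.card * S.card : ℕ) : ℝ) = cU * cS := by push_cast; rw [hcU, hcS]
  have hNe : ((S.card * T.card * U.card : ℕ) : ℝ) = cS * cT * cU := by push_cast; rw [hcS, hcT, hcU]
  have hTfil : ∀ (p : Equiv.Perm (Fin n) → Prop) [DecidablePred p], ((T.filter p).card : ℝ) ≤ cT :=
    fun p _ => by rw [hcT]; exact_mod_cast Finset.card_filter_le _ _
  have hSfil : ∀ (p : Equiv.Perm (Fin n) → Prop) [DecidablePred p], ((S.filter p).card : ℝ) ≤ cS :=
    fun p _ => by rw [hcS]; exact_mod_cast Finset.card_filter_le _ _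
  have hUcol : ∑ v : Fin n, ((U.filter fun u => u k = v).card : ℝ) = cU := by
    rw [hcU]; exact sum_marginal_col U k
  have hcUne : cU ≠ 0 := hcU0.ne'
  -- the hub-mass hypothesis, left-associated and over `cS, cT, cU`
  have hlow' : 2 * q ≤ ∑ v : Fin n, ((U.filter fun u => u k = v).card : ℝ) / cU *
      (((T.filter fun t => t⁻¹ v ∈ J₀).card : ℝ) / cT) *
        (((S.filter fun s => s⁻¹ v ∈ I₀).card : ℝ) / cS) := by
    calc 2 * q ≤ _ := hlow
      _ = _ := Finset.sum_congr rfl fun v _ => by rw [hcS, hcT, hcU]; ring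
  clear_value cS cT cU
  /- 1. the marginals and the profiles -/
  set mA : Fin n → Fin n → ℝ :=
    fun i j => (((S ×ˢ T).filter fun st => st.2 j = st.1 i).card : ℝ) with hmA
  set mB : Fin n → Fin n → ℝ :=
    fun j k' => (((T ×ˢ U).filter fun tu => tu.2 k' = tu.1 j).card : ℝ) with hmB
  set mC : Fin n → Fin n → ℝ :=
    fun k' i => (((U ×ˢ S).filter fun us => us.2 i = us.1 k').card : ℝ) with hmC
  have hdA' : ∀ i j, dA i j = mA i j / (cS * cT) := fun i j => by rw [hdA, hαe]
  have hdB' : ∀ j k', dB j k' = mB j k' / (cT * cU) := fun j k' => by rw [hdB, hβe]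
  have hdC' : ∀ k' i, dC k' i = mC k' i / (cU * cS) := fun k' i => by rw [hdC, hγe]
  have hmA0 : ∀ i j, 0 ≤ mA i j := fun i j => by simp only [hmA]; exact Nat.cast_nonneg _
  have hdA0 : ∀ i j, 0 ≤ dA i j := fun i j =>
    (hdA' i j).symm ▸ div_nonneg (hmA0 i j) (mul_pos hcS0 hcT0).le
  clear_value mA mB mC
  /- 2. the three laws at the hub -/
  set μ : Fin n → ℝ := fun v => ((U.filter fun u => u k = v).card : ℝ) / cU with hμ
  set X : Fin n → ℝ := fun v => ((T.filter fun t => t⁻¹ v ∈ J₀).card : ℝ) / cT with hX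
  set Y : Fin n → ℝ := fun v => ((S.filter fun s => s⁻¹ v ∈ I₀).card : ℝ) / cS with hY
  have hμ0 : ∀ v, 0 ≤ μ v := fun v => by rw [hμ]; exact div_nonneg (Nat.cast_nonneg _) hcU0.le
  have hX0 : ∀ v, 0 ≤ X v := fun v => by rw [hX]; exact div_nonneg (Nat.cast_nonneg _) hcT0.le
  have hY0 : ∀ v, 0 ≤ Y v := fun v => by rw [hY]; exact div_nonneg (Nat.cast_nonneg _) hcS0.le
  have hX1 : ∀ v, X v ≤ 1 := fun v => by
    rw [hX]; dsimp only; rw [div_le_one hcT0]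
    exact hTfil _
  have hY1 : ∀ v, Y v ≤ 1 := fun v => by
    rw [hY]; dsimp only; rw [div_le_one hcS0]
    exact hSfil _
  have hμ1 : ∑ v : Fin n, μ v = 1 := by
    rw [hμ]; dsimp only
    rw [← Finset.sum_div, hUcol, div_self hcUne]
  have hsum : 2 * q ≤ ∑ v : Fin n, μ v * X v * Y v := by
    have e : ∑ v : Fin n, μ v * X v * Y v = ∑ v : Fin n, ((U.filter fun u => u k = v).card : ℝ) / cU *
        (((T.filter fun t => t⁻¹ v ∈ J₀).card : ℝ) / cT) *
          (((S.filter fun s => s⁻¹ v ∈ I₀).card : ℝ) / cS) := by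
      refine Finset.sum_congr rfl fun v _ => ?_
      rw [hμ, hX, hY]
    rw [e]; exact hlow'
  clear_value μ X Y
  -- scalar identities (kept free of the big definitions)
  have key2U : ∀ a b : ℝ, a / cU * (b / cT) = a * b / (cT * cU) := by
    intro a b; rw [div_mul_div_comm, mul_comm cU cT]
  have key2S : ∀ a b : ℝ, a / cU * (b / cS) = a * b / (cU * cS) := by
    intro a b; rw [div_mul_div_comm]
  have key2T : ∀ a b : ℝ, a / cT * (b / cS) = a * b / (cS * cT) := by
    intro a b; rw [div_mul_div_comm, mul_comm cT cS]
  /- 3. hub masses: `Σ_{j ∈ J₀} dB j k = Σ_v μ X ≥ Σ_v μ X Y ≥ 2q`, so `q ≤ β|J₀|`; same for rows -/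
  have hμXY_X : ∑ v : Fin n, μ v * X v * Y v ≤ ∑ v : Fin n, μ v * X v :=
    Finset.sum_le_sum fun v _ => by
      have h := mul_le_mul_of_nonneg_left (hY1 v) (mul_nonneg (hμ0 v) (hX0 v))
      rwa [mul_one] at h
  have hμXY_Y : ∑ v : Fin n, μ v * X v * Y v ≤ ∑ v : Fin n, μ v * Y v :=
    Finset.sum_le_sum fun v _ => by
      have h := mul_le_mul_of_nonneg_left (hX1 v) (mul_nonneg (hμ0 v) (hY0 v))
      calc μ v * X v * Y v = μ v * Y v * X v := by ring
        _ ≤ μ v * Y v * 1 := h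
        _ = μ v * Y v := mul_one _
  have hσ : ∑ v : Fin n, μ v * X v = ∑ j ∈ J₀, dB j k := by
    have hcol := sum_pairMarginal_col_block_eq T U J₀ k
    have hcolR : ∑ j ∈ J₀, mB j k = ∑ v : Fin n,
        ((U.filter fun u => u k = v).card : ℝ) * ((T.filter fun t => t⁻¹ v ∈ J₀).card : ℝ) := by
      simp only [hmB]; exact_mod_cast hcol
    have e1 : ∑ v : Fin n, μ v * X v = (∑ j ∈ J₀, mB j k) / (cT * cU) := by
      rw [hcolR, Finset.sum_div]
      refine Finset.sum_congr rfl fun v _ => ?_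
      rw [hμ, hX]; dsimp only
      rw [key2U]
    have e2 : (∑ j ∈ J₀, mB j k) / (cT * cU) = ∑ j ∈ J₀, dB j k := by
      rw [Finset.sum_div]
      exact Finset.sum_congr rfl fun j _ => (hdB' j k).symm
    rw [e1, e2]
  have hρ : ∑ v : Fin n, μ v * Y v = ∑ i ∈ I₀, dC k i := by
    have hrow := sum_pairMarginal_row_block_eq U S I₀ k
    have hrowR : ∑ i ∈ I₀, mC k i = ∑ v : Fin n,
        ((U.filter fun u => u k = v).card : ℝ) * ((S.filter fun s => s⁻¹ v ∈ I₀).card : ℝ) := by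
      simp only [hmC]; exact_mod_cast hrow
    have e1 : ∑ v : Fin n, μ v * Y v = (∑ i ∈ I₀, mC k i) / (cU * cS) := by
      rw [hrowR, Finset.sum_div]
      refine Finset.sum_congr rfl fun v _ => ?_
      rw [hμ, hY]; dsimp only
      rw [key2S]
    have e2 : (∑ i ∈ I₀, mC k i) / (cU * cS) = ∑ i ∈ I₀, dC k i := by
      rw [Finset.sum_div]
      exact Finset.sum_congr rfl fun i _ => (hdC' k i).symm
    rw [e1, e2]
  have hqJ : q ≤ β * J₀.card := by
    have h1 : ∑ j ∈ J₀, dB j k ≤ ∑ _j ∈ J₀, 2 * β := Finset.sum_le_sum fun j hj => (hJ₀ j hj).2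
    rw [Finset.sum_const, nsmul_eq_mul] at h1
    have h2 : 2 * q ≤ ∑ j ∈ J₀, dB j k := by rw [← hσ]; exact hsum.trans hμXY_X
    nlinarith
  have hqI : q ≤ γ * I₀.card := by
    have h1 : ∑ i ∈ I₀, dC k i ≤ ∑ _i ∈ I₀, 2 * γ := Finset.sum_le_sum fun i hi => (hI₀ i hi).2
    rw [Finset.sum_const, nsmul_eq_mul] at h1
    have h2 : 2 * q ≤ ∑ i ∈ I₀, dC k i := by rw [← hρ]; exact hsum.trans hμXY_Y
    nlinarith
  /- 4. FORCED HITS: `Σ_v X Y = Σ_{I₀ × J₀} dA ≤ (η/n)/(βγ)` -/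
  have hβγ : 0 < β * γ := mul_pos hβ hγ
  have hZ0 : 0 < η / n / (β * γ) := div_pos (div_pos hη hn0) hβγ
  have hforced : ∑ v : Fin n, X v * Y v ≤ η / n / (β * γ) := by
    -- the identity
    have hblock := sum_pairMarginal_block_eq S T I₀ J₀
    have hblockR : ∑ i ∈ I₀, ∑ j ∈ J₀, mA i j = ∑ v : Fin n,
        ((T.filter fun t => t⁻¹ v ∈ J₀).card : ℝ) * ((S.filter fun s => s⁻¹ v ∈ I₀).card : ℝ) := by
      simp only [hmA]; exact_mod_cast hblock
    have e1 : ∑ v : Fin n, X v * Y v = ∑ i ∈ I₀, ∑ j ∈ J₀, dA i j := by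
      have h : ∑ v : Fin n, X v * Y v = (∑ i ∈ I₀, ∑ j ∈ J₀, mA i j) / (cS * cT) := by
        rw [hblockR, Finset.sum_div]
        refine Finset.sum_congr rfl fun v _ => ?_
        rw [hX, hY]; dsimp only
        rw [key2T]
      rw [h, Finset.sum_div]
      refine Finset.sum_congr rfl fun i _ => ?_
      rw [Finset.sum_div]
      exact Finset.sum_congr rfl fun j _ => (hdA' i j).symm
    -- on the block `βγ·dA ≤ dA·dB·dC`
    have e2 : β * γ * ∑ i ∈ I₀, ∑ j ∈ J₀, dA i j ≤ ∑ i ∈ I₀, ∑ j ∈ J₀, dA i j * dB j k * dC k i := by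
      rw [Finset.mul_sum]
      refine Finset.sum_le_sum fun i hi => ?_
      rw [Finset.mul_sum]
      refine Finset.sum_le_sum fun j hj => ?_
      have hb : β ≤ dB j k := (hJ₀ j hj).1
      have hc : γ ≤ dC k i := (hI₀ i hi).1
      have hA : 0 ≤ dA i j := hdA0 i j
      calc β * γ * dA i j = dA i j * β * γ := by ring
        _ ≤ dA i j * dB j k * γ :=
            mul_le_mul_of_nonneg_right (mul_le_mul_of_nonneg_left hb hA) hγ.le
        _ ≤ dA i j * dB j k * dC k i :=
            mul_le_mul_of_nonneg_left hc (mul_nonneg hA (hβ.le.trans hb))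
    rw [e1, le_div_iff₀ hβγ]
    calc (∑ i ∈ I₀, ∑ j ∈ J₀, dA i j) * (β * γ) = β * γ * ∑ i ∈ I₀, ∑ j ∈ J₀, dA i j := mul_comm _ _
      _ ≤ ∑ i ∈ I₀, ∑ j ∈ J₀, dA i j * dB j k * dC k i := e2
      _ ≤ η / n := hΨ
  /- 5. a good common value -/
  obtain ⟨v, hv⟩ :=
    exists_good_value_of_sum μ X Y q (η / n / (β * γ)) hμ0 hμ1.le hX0 hY0 hq hZ0 hsum hforced
  /- 6. fibring at `(k, v)` -/
  have hfib := hub_fibring B hB hTPP I₀ J₀ k v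
  have hfibR : ((S.filter fun s => s⁻¹ v ∈ I₀).card : ℝ) * ((T.filter fun t => t⁻¹ v ∈ J₀).card : ℝ) *
      ((U.filter fun u => u k = v).card : ℝ) ≤ (I₀.card : ℝ) * (J₀.card : ℝ) * B := by
    exact_mod_cast hfib
  -- the sub-triple has volume `N · μ X Y`
  have key3 : ∀ a b c : ℝ, cS * cT * cU * (a / cU * (b / cT) * (c / cS)) = c * b * a := by
    intro a b c; field_simp
  have hvol : cS * cT * cU * (μ v * X v * Y v) =
      ((S.filter fun s => s⁻¹ v ∈ I₀).card : ℝ) * ((T.filter fun t => t⁻¹ v ∈ J₀).card : ℝ) *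
        ((U.filter fun u => u k = v).card : ℝ) := by
    rw [hμ, hX, hY]; dsimp only
    rw [key3]
  /- 7. assemble -/
  have hN0 : 0 < cS * cT * cU := mul_pos (mul_pos hcS0 hcT0) hcU0
  have h1 : cS * cT * cU * (q ^ 2 / (η / n / (β * γ))) ≤ (J₀.card : ℝ) * I₀.card * B := by
    calc cS * cT * cU * (q ^ 2 / (η / n / (β * γ))) ≤ cS * cT * cU * (μ v * X v * Y v) :=
          mul_le_mul_of_nonneg_left hv hN0.le
      _ = _ := hvol
      _ ≤ (I₀.card : ℝ) * (J₀.card : ℝ) * B := hfibR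
      _ = (J₀.card : ℝ) * I₀.card * B := by ring
  -- `q²/Z = q²·n·βγ/η`
  have h2 : cS * cT * cU * q ^ 2 * n * (β * γ) ≤ (J₀.card : ℝ) * I₀.card * B * η := by
    have e : cS * cT * cU * (q ^ 2 / (η / n / (β * γ))) = cS * cT * cU * q ^ 2 * n * (β * γ) / η := by
      rw [div_div, div_div_eq_mul_div]; ring
    rw [e, div_le_iff₀ hη] at h1
    exact h1
  -- `q² ≤ βγ·|J₀||I₀|`
  have hP0 : (0 : ℝ) ≤ (J₀.card : ℝ) * I₀.card := by positivity
  have h3 : q ^ 2 ≤ β * γ * ((J₀.card : ℝ) * I₀.card) := by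
    have h := mul_le_mul hqJ hqI hq.le (mul_nonneg hβ.le (Nat.cast_nonneg _))
    calc q ^ 2 = q * q := sq q
      _ ≤ β * ↑J₀.card * (γ * ↑I₀.card) := h
      _ = β * γ * ((J₀.card : ℝ) * I₀.card) := by ring
  have hB0 : (0 : ℝ) ≤ B := Nat.cast_nonneg _
  have h4 : cS * cT * cU * (q ^ 4 * n) ≤ W ^ 2 * η * B := by
    calc cS * cT * cU * (q ^ 4 * n) = cS * cT * cU * q ^ 2 * n * q ^ 2 := by ring
      _ ≤ cS * cT * cU * q ^ 2 * n * (β * γ * ((J₀.card : ℝ) * I₀.card)) :=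
          mul_le_mul_of_nonneg_left h3
            (mul_nonneg (mul_nonneg hN0.le (pow_nonneg hq.le 2)) hn0.le)
      _ = cS * cT * cU * q ^ 2 * n * (β * γ) * ((J₀.card : ℝ) * I₀.card) := by ring
      _ ≤ (J₀.card : ℝ) * I₀.card * B * η * ((J₀.card : ℝ) * I₀.card) :=
          mul_le_mul_of_nonneg_right h2 hP0
      _ = ((J₀.card : ℝ) * I₀.card) ^ 2 * (η * B) := by ring
      _ ≤ W ^ 2 * (η * B) :=
          mul_le_mul_of_nonneg_right (pow_le_pow_left₀ hP0 hW 2) (mul_nonneg hη.le hB0)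
      _ = W ^ 2 * η * B := by ring
  rw [hNe, le_div_iff₀ (mul_pos (pow_pos hq 4) hn0)]
  exact h4

end Summit.MatrixMultiplication.MatrixMultiplication.Theorems.PolynomialSlack
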